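import Literature.NumberTheory.Automorphic.ReciprocityGLnPotentialModularity
import HarnessLib

/-!
# Modularity of elliptic curves over imaginary quadratic fields (Caraiani–Newton 2023, Thm. 1.1)

Topic `Literature/NumberTheory/Automorphic` (reciprocity for `GL₂` over CM fields; companion of
`ReciprocityGLn.lean`, whose vocabulary — `CuspidalAutomorphicRepData`, `HasWeightZero`,
`HasSatakeParamAt`, `frobTraceAt` — and whose rendering of "`E` is modular / automorphic" in
**lang.S28** (`potentiallyModular_ellipticCurve_CM`) we follow verbatim, with `L = K = F`).

A. Caraiani, J. Newton, *On the modularity of elliptic curves over imaginary quadratic fields*,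
arXiv:2301.10509 [CaraianiNewton2023]:

* p. 2 (Introduction): "We say that an elliptic curve `E/F` is modular if either `E` has complex
  multiplication or if there exists a cuspidal automorphic representation `π` of `GL₂(𝔸_F)` of
  parallel weight `2` whose associated `L`-function is the same as the `L`-function of `E`."
  (§6, after Thm. 6.1: "either `E` has CM, or there is a cuspidal … automorphic representation `π`
  of `GL₂(𝔸_F)` which is regular algebraic of weight `0`, with `r_{π,ι} ≅ r_{E,p}^∨`".)
  Rendered as `IsModularEllipticCurve F E` below.
* p. 2: "Recall that the modular curve `X₀(15)` is an elliptic curve of rank zero over `ℚ` — it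
  is the curve with Cremona label 15A1"; §7 (proof of Cor. 7.1.2): "`X₀(15) = X(b3, b5)` is an
  elliptic curve … Cremona label 15A1 (see [FLHS15, Lemma 5.6]) … A Legendre form for `X₀(15)/ℚ`
  is `y² = x(x + 16)(x + 25)`." Rendered as the Weierstrass curve `X0FifteenLegendre` over `ℚ`.
* **Theorem 1.1 (= Corollary 7.1.2).** "Let `F` be an imaginary quadratic field such that the
  Mordell–Weil group `X₀(15)(F)` is finite. Then every elliptic curve `E/F` is modular."
  Vendored as the NAMED FACT `CaraianiNewton2023_modularity` (D-0014).

## Rendering and faithfulness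

* `F` imaginary quadratic: `NumberField F`, `NumberField.IsTotallyComplex F`,
  `Module.finrank ℚ F = 2` (as in the route statements of Langlands/EisensteinDefectOne).
* "`X₀(15)(F)` finite": finiteness of the type of `F`-rational points (Mathlib
  `WeierstrassCurve.Affine.Point`, the point at infinity included) of the base change to `F` of
  the printed Legendre model `y² = x(x+16)(x+25)` of `X₀(15)/ℚ`; `X₀(15)(F)` and the `F`-points
  of any `ℚ`-isomorphic Weierstrass model are in bijection, so this is the printed hypothesis
  (the identification `X₀(15) ≅` 15A1 `≅` this Legendre curve over `ℚ` is the source's, §7 and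
  [FLHS15, Lemma 5.6]).
* "every elliptic curve `E/F`": every Weierstrass model `E` over `𝓞 F` with `Δ(E) ≠ 0` (every
  elliptic curve over `F` has such an integral model; `frobTraceAt E w = q_w + 1 - #E(k_w)` is the
  trace of Frobenius at the cofinitely many places of good reduction of the model, and the
  conclusion only constrains cofinitely many `w`), exactly as in lang.S28.
* "modular": geometric CM (`(E.baseChange F).HasCM`, `Isogeny.lean`) OR a cuspidal automorphic
  representation `π` of `GL₂(𝔸_F)` of weight zero (`HasWeightZero` = cohomological for the trivial
  coefficient system = parallel weight `2`) whose Hecke eigenvalue `q_w^{1/2} e₁(α_w)` at all but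
  finitely many finite places `w` is `a_w(E)` (unitary normalisation of `HasSatakeParamAt`, as in
  lang.S28). Equality of the full `L`-functions implies this cofinite matching of the `T_w`
  eigenvalues, so the rendered conclusion is implied by (is not stronger than) the printed one;
  reading "has complex multiplication" as geometric CM likewise only weakens the conclusion.
* Library fit. Two renderings of "`E` is automorphic" already exist and are NOT duplicated:
  `IsAutomorphicOfWeightZero E` (`ReciprocityGLnPotentialModularity.lean`: weight-zero cuspidal
  `π` with Hecke polynomial `X² - a_w X + q_w` at EVERY place `w ∤ Δ(E)`) and
  `WeierstrassCurve.IsModular` (`Sweep1.lean`: an `L²`-cuspidal `Π` whose Satake parameters match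
  Mathlib's `localPolynomial` at almost all places). Caraiani–Newton's "modular" differs from
  both — it has the CM escape clause and only asserts equality of `L`-functions — so it is
  rendered as the disjunction `IsModularEllipticCurve` whose automorphic alternative is the
  COFINITE trace matching of lang.S28 (the weakest of the three); the bridge
  `IsModularEllipticCurve.of_isAutomorphicOfWeightZero` (via
  `IsAutomorphicOfWeightZero.eventually_hasSatakeParamAt`) records that the stronger tree notion
  implies it.
* NOT vendored here (no vocabulary in the tree; recorded for the requesting route
  Langlands/EisensteinDefectOne, items stmt-Langlands-1709/1711): the `P`-ordinary Hida theory of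
  §§2–4 (the `P`-ordinary Hecke algebra `𝕋^{P-ord}(K^p)_𝔪` of completed cohomology as a finite
  `Λ`-algebra carrying a `2`-dimensional determinant with ordinary local–global compatibility at
  `v ∣ p`), the ordinary automorphy lifting theorem (Thm. 5.2) and Thm. 6.1 / Cor. 6.1.1
  (modularity from residual irreducibility at `3` or `5`); nor the remark that Thm. 1.1 applies to
  `ℚ(√-d)`, `d = 1, 2, 3, 5` (a Magma/Sage rank computation, p. 2).

## References

* A. Caraiani, J. Newton, *On the modularity of elliptic curves over imaginary quadratic fields*,
  arXiv:2301.10509 (2023): p. 2 (definition of modular; Thm. 1.1), §6 (Thm. 6.1 and the sentence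
  following it), §7 (Cor. 7.1.2 and its proof: `X₀(15) = X(b3,b5)`, Cremona 15A1, Legendre form).
  [CaraianiNewton2023]
* P. Allen et al., *Potential automorphy over CM fields*, Ann. of Math. 197 (2023), Thm. 1.0.1 —
  the shape of the conclusion (lang.S28, `ReciprocityGLn.lean`). [ACCGHLNSTT2023]
-/

open scoped NumberField
open NumberField IsDedekindDomain

noncomputable section

namespace Literature.NumberTheory.Automorphic

/-! ### The hypothesis: `X₀(15)` in Legendre form -/

/-- The modular curve `X₀(15)` as an elliptic curve over `ℚ`, in the Legendre form printed by
Caraiani–Newton: `y² = x(x + 16)(x + 25) = x³ + 41x² + 400x` (Weierstrass coefficients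
`a₁ = 0, a₂ = 41, a₃ = 0, a₄ = 400, a₆ = 0`); `ℚ`-isomorphic to the curve of Cremona label 15A1
(`X₀(15) = X(b3, b5)`, [FLHS15, Lemma 5.6] as cited there), `X₀(15)(ℚ) ≅ ℤ/2 × ℤ/4`.
[cite: CaraianiNewton2023, §7 (proof of Cor. 7.1.2)] -/
def X0FifteenLegendre : WeierstrassCurve ℚ :=
  ⟨0, 41, 0, 400, 0⟩

/-- The Legendre model of `X₀(15)` has discriminant `Δ = 16 · 16² · 25² · 9² = 207360000 ≠ 0`
(roots `0, -16, -25` of the cubic). [folklore] -/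
theorem X0FifteenLegendre_Δ : X0FifteenLegendre.Δ = 207360000 := by
  norm_num [X0FifteenLegendre, WeierstrassCurve.Δ, WeierstrassCurve.b₂, WeierstrassCurve.b₄,
    WeierstrassCurve.b₆, WeierstrassCurve.b₈]

/-- The Legendre model of `X₀(15)` is an elliptic curve over `ℚ` (`Δ ≠ 0`). [folklore] -/
instance X0FifteenLegendre.isElliptic : X0FifteenLegendre.IsElliptic := by
  rw [WeierstrassCurve.isElliptic_iff, X0FifteenLegendre_Δ]
  norm_num

/-! ### "`E` is modular" for an elliptic curve over a number field -/

/-- **`E/F` is modular** in the sense of Caraiani–Newton, p. 2, for an integral Weierstrass model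
`E` over `𝓞 F` of an elliptic curve over the number field `F`: either `E` has (geometric) complex
multiplication, or there is a cuspidal automorphic representation `π` of `GL₂(𝔸_F)` of weight zero
(parallel weight `2`) such that at all but finitely many finite places `w` of `F`, `π_w` is
unramified with Satake parameter `α = {α_w, β_w}` and `q_w^{1/2}(α_w + β_w) = a_w(E)`
(`frobTraceAt`; the `T_w`-eigenvalue matches the trace of Frobenius — the cofinite shadow of
"`L(π, s) = L(E, s)`", in the unitary normalisation of `HasSatakeParamAt`, verbatim the conclusion
of lang.S28 `potentiallyModular_ellipticCurve_CM` with `L = F`). The proof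
`hF : isCompact_glFiniteIntegralLevel 2 F` needed to type `π` is part of the existential (it
holds, `isCompact_glFiniteIntegralLevel_holds`).
[cite: CaraianiNewton2023, p. 2 (definition of modular) and §6 (after Thm. 6.1)] -/
def IsModularEllipticCurve (F : Type) [Field F] [NumberField F] (E : WeierstrassCurve (𝓞 F)) :
    Prop :=
  (E.baseChange F).HasCM ∨
    ∃ (hF : isCompact_glFiniteIntegralLevel 2 F) (π : CuspidalAutomorphicRepData 2 F hF),
      π.1.HasWeightZero ∧
        ∀ᶠ w : HeightOneSpectrum (𝓞 F) in Filter.cofinite, ∃ α : Multiset ℂ,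
          π.1.HasSatakeParamAt w α ∧
            ((Real.sqrt w.residueCard : ℝ) : ℂ) * α.sum = (frobTraceAt E w : ℂ)

/-- A curve with geometric CM is modular by definition (first alternative). [folklore] -/
theorem IsModularEllipticCurve.of_hasCM {F : Type} [Field F] [NumberField F]
    {E : WeierstrassCurve (𝓞 F)} (h : (E.baseChange F).HasCM) : IsModularEllipticCurve F E :=
  Or.inl h

/-- The tree's stronger notion implies Caraiani–Newton modularity: if the model `E` (`Δ ≠ 0`) is
automorphic of weight zero in the sense of `IsAutomorphicOfWeightZero` (Hecke polynomial
`X² - a_w X + q_w` at every `w ∤ Δ(E)`), then it is modular in the present (cofinite, trace)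
sense (`IsAutomorphicOfWeightZero.eventually_hasSatakeParamAt`). [folklore] -/
theorem IsModularEllipticCurve.of_isAutomorphicOfWeightZero {F : Type} [Field F] [NumberField F]
    {E : WeierstrassCurve (𝓞 F)} (hΔ : E.Δ ≠ 0) (h : IsAutomorphicOfWeightZero E) :
    IsModularEllipticCurve F E :=
  Or.inr (h.eventually_hasSatakeParamAt hΔ)

/-! ### Caraiani–Newton, Theorem 1.1 (named fact) -/

/-- **Caraiani–Newton (2023), Theorem 1.1 (= Corollary 7.1.2): modularity of elliptic curves over
imaginary quadratic fields with `X₀(15)(F)` finite.** Let `F` be an imaginary quadratic field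
(a totally complex number field of degree `2`) such that the Mordell–Weil group `X₀(15)(F)` is
finite — rendered: the `F`-rational points of the printed Legendre model
`X0FifteenLegendre : y² = x(x+16)(x+25)` of `X₀(15)/ℚ` form a finite set. Then every elliptic
curve over `F` — every Weierstrass model `E` over `𝓞 F` with `Δ(E) ≠ 0` — is modular
(`IsModularEllipticCurve F E`). The source notes (p. 2) that the hypothesis holds for
`F = ℚ(√-d)`, `d = 1, 2, 3, 5` (computer rank computation) and for infinitely many imaginary
quadratic fields [MN15, Thm. 3]; these remarks are not part of the fact. A named fact (D-0014):
users take `(h : CaraianiNewton2023_modularity)`.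
[cite: CaraianiNewton2023, Thm. 1.1 (Cor. 7.1.2)] -/
def CaraianiNewton2023_modularity : Prop :=
  ∀ (F : Type) [Field F] [NumberField F], IsTotallyComplex F → Module.finrank ℚ F = 2 →
    Finite (X0FifteenLegendre.baseChange F).toAffine.Point →
      ∀ E : WeierstrassCurve (𝓞 F), E.Δ ≠ 0 → IsModularEllipticCurve F E

end Literature.NumberTheory.Automorphic

end
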